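import Summits.ValiantsHypothesis.ValiantsHypothesis.Theses.SymmetroidDescartes
import Literature.Computability.AlgebraicComplexity.RealTauKnownCases

/-!
# Crux `DerivedPencilRolleQuasi` (stmt-ValiantsHypothesis-18064) — line `imm-halving`

Strategist line (planner-cstrat-stmt-ValiantsHypothesis-18064-s1-0, 2026-08-17), lens TRANSFER + DECOMPOSITION
(normal form + induction on product LENGTH).  Realises, on THIS crux, the sibling crux idea
`Cruxes/MatrixDescartes/Ideas/imm-length-halving.md` — whose budget match is exact here: the crux's additive budget
`(K+1)^{A K} · 2^{(log₂ m + 2)^A}` is precisely the shape produced by a length-halving recursion with polynomial loss per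
level (`log₂ L ≤ log₂ m + O(1)` levels), the recursion by which Gusfield (1980) bounds the cancellation-free
(tropical / parametric-shortest-path) twin of the count by `(2w)^{⌈log₂ L⌉}`.

* `DetToImm` (stub, KNOWN — Mahajan–Vinay 1997 clow sequences, "VBP ⊇ det" over any commutative ring): the determinant of
  an `m × m` lacunary pencil `Σ_l X^{d_l} T_l` is an ENTRY of a product of `L ≤ m + 2` lacunary pencils of width
  `w ≤ (m+2)^3` over the SAME exponents `d` (every ABP edge carries `±` one entry of the pencil).  With it the Rolle term,
  the symmetry and the invertibility hypotheses of the crux are all discharged as idle: the crux holds with `C = 0`.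
* `HalvingStep` (stub, OPEN — the content): doubling the length of a product of lacunary pencils multiplies the
  positive-root capacity of its entries by at most a polynomial in `(w, K, L)`:
  `EntryBound d w L B → EntryBound d w (2L) ((w+K+L+2)^c (B+1))`.  Its tropical twin (`min ↦ +`, `+ ↦ ×`) is the
  one-line lemma "the upper envelope of `w` sums of two convex PL functions with `b` pieces each has `≤ 2wb` pieces".
* Base (PROVED here): a single pencil's entries are `(K+1)`-nomials, `Z₊ ≤ K` (sparse Descartes, tree lemma
  `card_roots_toFinset_filter_pos_lt_card_support`); the empty product is the identity.
* Composition (PROVED here): iterate the step `j = ⌊log₂(m+2)⌋ + 1` times, `Z₊ ≤ (K+1)·(2Q)^j`, `Q = (w+K+2^j+2)^c`, and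
  absorb into the budget with `A = 12c + 4` (case split `log₂(K+1) ≤ log₂ m + 2` or not, as in line `bmd-transfer`).

Stubs (sorries live ONLY here): `stub_detToImm` (known, XL in Lean), `stub_halving` (open; hardest).
`DerivedPencilRolleQuasi_of` concludes the crux BY NAME (applying `derivedPencilRolleQuasi_of_stubs` to the two stubs).
-/

set_option linter.dupNamespace false
set_option linter.unusedVariables false

namespace Summit.ValiantsHypothesis.ValiantsHypothesis.Cruxes.DerivedPencilRolleQuasi.ImmHalving

open Polynomial Matrix Finset
open scoped BigOperators

/-! ## Vocabulary -/

/-- The lacunary pencil `Σ_l X^{d_l} • M_l` of width `w` (verbatim the crux's expression). -/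
noncomputable def pencil {K w : ℕ} (d : Fin (K + 1) → ℕ) (M : Fin (K + 1) → Matrix (Fin w) (Fin w) ℝ) :
    Matrix (Fin w) (Fin w) ℝ[X] :=
  ∑ l, (X : ℝ[X]) ^ d l • (M l).map C

/-- The length-`L` product of lacunary pencils of width `w` over the exponents `d` (iterated matrix product). -/
noncomputable def cocycle {K w L : ℕ} (d : Fin (K + 1) → ℕ) (M : Fin L → Fin (K + 1) → Matrix (Fin w) (Fin w) ℝ) :
    Matrix (Fin w) (Fin w) ℝ[X] :=
  (List.ofFn fun s : Fin L => pencil d (M s)).prod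

/-- Number of distinct positive roots of a real polynomial (`Z₊`; the zero polynomial has none). -/
noncomputable def posRoots (p : ℝ[X]) : ℕ :=
  (p.roots.toFinset.filter (fun t => 0 < t)).card

/-- `EntryBound d w L B`: every entry of every width-`w` product of length AT MOST `L` of lacunary pencils over `d` has at
most `B` distinct positive roots. -/
def EntryBound {K : ℕ} (d : Fin (K + 1) → ℕ) (w L B : ℕ) : Prop :=
  ∀ L' : ℕ, L' ≤ L → ∀ (M : Fin L' → Fin (K + 1) → Matrix (Fin w) (Fin w) ℝ) (i j : Fin w),
    posRoots (cocycle d M i j) ≤ B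

theorem entryBound_mono {K : ℕ} (d : Fin (K + 1) → ℕ) (w L B B' : ℕ) (h : EntryBound d w L B) (hB : B ≤ B') :
    EntryBound d w L B' :=
  fun L' hL' M i j => (h L' hL' M i j).trans hB

/-! ## The two stub statements -/

/-- **Det → IMM over the same exponents** (Mahajan–Vinay 1997, Thm. "det ∈ VBP" via clow sequences; width `O(m²)`,
length `m + O(1)`, every edge labelled by `±` an entry): the determinant of an `m × m` lacunary pencil is an entry of a
product of at most `m + 2` lacunary pencils of width at most `(m+2)^3` over the same exponent tuple `d`. -/
def DetToImm : Prop :=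
  ∀ (m K : ℕ) (T : Fin (K + 1) → Matrix (Fin m) (Fin m) ℝ) (d : Fin (K + 1) → ℕ),
    ∃ w L : ℕ, w ≤ (m + 2) ^ 3 ∧ L ≤ m + 2 ∧
      ∃ (M : Fin L → Fin (K + 1) → Matrix (Fin w) (Fin w) ℝ) (i j : Fin w), (pencil d T).det = cocycle d M i j

/-- **The signed halving step** (OPEN; the content of the line): doubling the length multiplies the positive-root
capacity of the entries by at most a polynomial in `(w, K, L)`. -/
def HalvingStep : Prop :=
  ∃ c : ℕ, ∀ (K w L B : ℕ) (d : Fin (K + 1) → ℕ),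
    EntryBound d w L B → EntryBound d w (2 * L) ((w + K + L + 2) ^ c * (B + 1))

/-! ## Stubs (sorries live ONLY here) -/

/-- STUB (known theorem, XL in Lean): Mahajan–Vinay. -/
theorem stub_detToImm : DetToImm := by
  sorry

/-- STUB (open; the hard one): the signed halving step. -/
theorem stub_halving : HalvingStep := by
  sorry

/-! ## Base of the recursion (proved): length ≤ 1 -/

/-- Entries of a single pencil are `(K+1)`-nomials `Σ_l C(c_l) X^{d_l}`. -/
theorem pencil_apply {K w : ℕ} (d : Fin (K + 1) → ℕ) (M : Fin (K + 1) → Matrix (Fin w) (Fin w) ℝ) (i j : Fin w) :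
    pencil d M i j = ∑ l, C (M l i j) * (X : ℝ[X]) ^ d l := by
  unfold pencil
  simp only [Matrix.sum_apply, Matrix.smul_apply, Matrix.map_apply, smul_eq_mul]
  exact Finset.sum_congr rfl fun l _ => mul_comm _ _

/-- Sparse Descartes for a `(K+1)`-nomial written over an exponent tuple: at most `K` distinct positive roots. -/
theorem posRoots_sum_C_mul_X_pow_le {K : ℕ} (d : Fin (K + 1) → ℕ) (c : Fin (K + 1) → ℝ) :
    posRoots (∑ l, C (c l) * (X : ℝ[X]) ^ d l) ≤ K := by
  set P : ℝ[X] := ∑ l, C (c l) * (X : ℝ[X]) ^ d l with hP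
  by_cases h0 : P = 0
  · simp [posRoots, h0]
  · have hsupp : P.support ⊆ Finset.univ.image d := by
      intro n hn
      rw [Polynomial.mem_support_iff] at hn
      rw [Finset.mem_image]
      by_contra hne
      push Not at hne
      apply hn
      rw [hP, Polynomial.finsetSum_coeff]
      refine Finset.sum_eq_zero fun l _ => ?_
      rw [Polynomial.coeff_C_mul_X_pow]
      have : n ≠ d l := fun h => hne l (Finset.mem_univ l) h.symm
      simp [this]
    have hcard : P.support.card ≤ K + 1 :=
      (Finset.card_le_card hsupp).trans ((Finset.card_image_le).trans (by simp))
    have hlt := Literature.Computability.AlgebraicComplexity.card_roots_toFinset_filter_pos_lt_card_support h0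
    unfold posRoots
    have : (P.roots.toFinset.filter (fun t => 0 < t)).card = (P.roots.toFinset.filter (0 < ·)).card := rfl
    omega

/-- The base: products of length `≤ 1` (the identity, or one pencil) have entries with at most `K` positive roots. -/
theorem entryBound_one {K : ℕ} (d : Fin (K + 1) → ℕ) (w : ℕ) : EntryBound d w 1 K := by
  intro L' hL' M i j
  interval_cases L'
  · -- empty product: the identity matrix, constant entries
    have hc : cocycle d M = 1 := by
      unfold cocycle
      simp
    rw [hc, Matrix.one_apply]
    split_ifs <;> simp [posRoots]
  · -- one pencil
    have hc : cocycle d M = pencil d (M 0) := by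
      unfold cocycle
      simp [List.ofFn_succ]
    rw [hc, pencil_apply]
    exact posRoots_sum_C_mul_X_pow_le d _

/-! ## Iterating the halving step (proved) -/

/-- After `i` halvings from length `1`: length `2^i`, bound `(K+1)·(2Q)^i` for any `Q` dominating the per-level losses. -/
theorem entryBound_two_pow {K : ℕ} (d : Fin (K + 1) → ℕ) (w c jmax : ℕ)
    (hH : ∀ (L B : ℕ), EntryBound d w L B → EntryBound d w (2 * L) ((w + K + L + 2) ^ c * (B + 1))) :
    ∀ i : ℕ, i ≤ jmax → EntryBound d w (2 ^ i) ((K + 1) * (2 * (w + K + 2 ^ jmax + 2) ^ c) ^ i) := by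
  set Q : ℕ := (w + K + 2 ^ jmax + 2) ^ c with hQ
  intro i
  induction i with
  | zero =>
    intro _
    simpa using entryBound_mono d w 1 K (K + 1) (entryBound_one d w) (Nat.le_succ K)
  | succ i ih =>
    intro hi
    have hprev := ih (Nat.le_of_succ_le hi)
    have hstep := hH (2 ^ i) _ hprev
    have h2 : 2 * 2 ^ i = 2 ^ (i + 1) := by ring
    rw [h2] at hstep
    refine entryBound_mono d w _ _ _ hstep ?_
    -- `(w+K+2^i+2)^c · ((K+1)(2Q)^i + 1) ≤ (K+1)(2Q)^{i+1}`
    have hPi : (w + K + 2 ^ i + 2) ^ c ≤ Q := by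
      rw [hQ]
      exact Nat.pow_le_pow_left (by
        have : 2 ^ i ≤ 2 ^ jmax := Nat.pow_le_pow_right (by norm_num) (by omega)
        omega) c
    have hone : 1 ≤ (K + 1) * (2 * Q) ^ i := Nat.one_le_iff_ne_zero.2 (by positivity)
    calc (w + K + 2 ^ i + 2) ^ c * ((K + 1) * (2 * Q) ^ i + 1)
        ≤ Q * ((K + 1) * (2 * Q) ^ i + (K + 1) * (2 * Q) ^ i) :=
          Nat.mul_le_mul hPi (Nat.add_le_add_left hone _)
      _ = (K + 1) * ((2 * Q) ^ i * (2 * Q)) := by ring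
      _ = (K + 1) * (2 * Q) ^ (i + 1) := by rw [← pow_succ]

/-! ## Arithmetic of the budget (proved) -/

/-- `m + 2 ≤ 2^{⌊log₂ m⌋ + 2}`. -/
theorem add_two_le_two_pow_log (m : ℕ) : m + 2 ≤ 2 ^ (Nat.log 2 m + 2) := by
  have h := Nat.lt_pow_succ_log_self (b := 2) one_lt_two m
  have h2 : 2 ^ (Nat.log 2 m + 2) = 2 * 2 ^ (Nat.log 2 m).succ := by
    rw [Nat.succ_eq_add_one, pow_succ]; ring
  have h3 : 1 ≤ 2 ^ (Nat.log 2 m).succ := Nat.one_le_two_pow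
  omega

/-- `K + 2 ≤ 2^{⌊log₂ (K+1)⌋ + 1}`. -/
theorem add_two_le_two_pow_log_succ (K : ℕ) : K + 2 ≤ 2 ^ (Nat.log 2 (K + 1) + 1) := by
  have h := Nat.lt_pow_succ_log_self (b := 2) one_lt_two (K + 1)
  rw [Nat.succ_eq_add_one] at h
  omega

/-- `⌊log₂(m+2)⌋ ≤ ⌊log₂ m⌋ + 2`. -/
theorem log_add_two_le (m : ℕ) : Nat.log 2 (m + 2) ≤ Nat.log 2 m + 2 := by
  calc Nat.log 2 (m + 2) ≤ Nat.log 2 (2 ^ (Nat.log 2 m + 2)) := Nat.log_mono_right (add_two_le_two_pow_log m)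
    _ = Nat.log 2 m + 2 := Nat.log_pow (by norm_num) _

/-- The polynomial-in-`z` exponent is at most `(12c+3) z²` for `z ≥ 2`. -/
theorem exponent_le_sq (c z : ℕ) (hz : 2 ≤ z) : z + 1 + (c * (4 * z + 3) + 1) * (z + 1) ≤ (12 * c + 3) * z ^ 2 := by
  have h1 : 2 * (c * z) ≤ c * z * z := by
    calc 2 * (c * z) ≤ z * (c * z) := Nat.mul_le_mul_right _ hz
      _ = c * z * z := by ring
  have h2 : 2 * c ≤ c * z := by
    calc 2 * c = c * 2 := by ring
      _ ≤ c * z := Nat.mul_le_mul_left _ hz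
  have h3 : 2 * z ≤ z * z := Nat.mul_le_mul_right _ hz
  nlinarith

/-- `(12c+3) z² ≤ z^{12c+4}` for `z ≥ 2`. -/
theorem sq_le_pow (c z : ℕ) (hz : 2 ≤ z) : (12 * c + 3) * z ^ 2 ≤ z ^ (12 * c + 4) := by
  have h1 : 12 * c + 3 ≤ 2 ^ (12 * c + 2) := Nat.lt_two_pow_self
  have h2 : 2 ^ (12 * c + 2) ≤ z ^ (12 * c + 2) := Nat.pow_le_pow_left hz _
  calc (12 * c + 3) * z ^ 2 ≤ z ^ (12 * c + 2) * z ^ 2 := Nat.mul_le_mul_right _ (h1.trans h2)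
    _ = z ^ (12 * c + 4) := by ring

/-- The total exponent fits the budget exponent: `n + 1 + (c(3x+n+3)+1)(x+1) ≤ n·(A K) + x^A`, `A = 12c + 4`. -/
theorem exponent_le_budget (c x n K : ℕ) (hx : 2 ≤ x) (hnK : n ≤ K) :
    n + 1 + (c * (3 * x + n + 3) + 1) * (x + 1) ≤ n * ((12 * c + 4) * K) + x ^ (12 * c + 4) := by
  rcases le_or_gt n x with hnx | hxn
  · have h1 : n + 1 + (c * (3 * x + n + 3) + 1) * (x + 1) ≤ x + 1 + (c * (4 * x + 3) + 1) * (x + 1) := by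
      have : c * (3 * x + n + 3) ≤ c * (4 * x + 3) := Nat.mul_le_mul_left _ (by omega)
      nlinarith
    calc n + 1 + (c * (3 * x + n + 3) + 1) * (x + 1) ≤ (12 * c + 3) * x ^ 2 := h1.trans (exponent_le_sq c x hx)
      _ ≤ x ^ (12 * c + 4) := sq_le_pow c x hx
      _ ≤ n * ((12 * c + 4) * K) + x ^ (12 * c + 4) := Nat.le_add_left _ _
  · have hn2 : 2 ≤ n := by omega
    have h1 : n + 1 + (c * (3 * x + n + 3) + 1) * (x + 1) ≤ n + 1 + (c * (4 * n + 3) + 1) * (n + 1) := by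
      have : c * (3 * x + n + 3) ≤ c * (4 * n + 3) := Nat.mul_le_mul_left _ (by omega)
      nlinarith
    calc n + 1 + (c * (3 * x + n + 3) + 1) * (x + 1) ≤ (12 * c + 3) * n ^ 2 := h1.trans (exponent_le_sq c n hn2)
      _ ≤ (12 * c + 4) * n ^ 2 := Nat.mul_le_mul_right _ (by omega)
      _ = n * ((12 * c + 4) * n) := by ring
      _ ≤ n * ((12 * c + 4) * K) := Nat.mul_le_mul_left _ (Nat.mul_le_mul_left _ hnK)
      _ ≤ n * ((12 * c + 4) * K) + x ^ (12 * c + 4) := Nat.le_add_right _ _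

/-- **Absorption.** With `w ≤ (m+2)^3`, `j = ⌊log₂(m+2)⌋ + 1`: `(K+1)·(2 (w+K+2^j+2)^c)^j` fits the crux budget at
`A = 12c + 4`. -/
theorem budget_absorbs (c m K w : ℕ) (hw : w ≤ (m + 2) ^ 3) :
    (K + 1) * (2 * (w + K + 2 ^ (Nat.log 2 (m + 2) + 1) + 2) ^ c) ^ (Nat.log 2 (m + 2) + 1) ≤
      (K + 1) ^ ((12 * c + 4) * K) * 2 ^ (Nat.log 2 m + 2) ^ (12 * c + 4) := by
  set x : ℕ := Nat.log 2 m + 2 with hx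
  set n : ℕ := Nat.log 2 (K + 1) with hn
  set j : ℕ := Nat.log 2 (m + 2) + 1 with hj
  set A : ℕ := 12 * c + 4 with hA
  have hx2 : 2 ≤ x := by omega
  have hjx : j ≤ x + 1 := by have := log_add_two_le m; omega
  -- the base of the loss is at most `2^{3x+n+3}`
  have hm2 : m + 2 ≤ 2 ^ x := add_two_le_two_pow_log m
  have hw' : w ≤ 2 ^ (3 * x) := by
    calc w ≤ (m + 2) ^ 3 := hw
      _ ≤ (2 ^ x) ^ 3 := Nat.pow_le_pow_left hm2 3
      _ = 2 ^ (3 * x) := by rw [← pow_mul, mul_comm]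
  have hK2 : K + 2 ≤ 2 ^ (n + 1) := add_two_le_two_pow_log_succ K
  have h2j : 2 ^ j ≤ 2 ^ (x + 1) := Nat.pow_le_pow_right (by norm_num) hjx
  set y : ℕ := 3 * x + n + 3 with hy
  have hbase : w + K + 2 ^ j + 2 ≤ 2 ^ y := by
    have e1 : 2 ^ (3 * x) ≤ 2 ^ (3 * x + n + 1) := Nat.pow_le_pow_right (by norm_num) (by omega)
    have e2 : 2 ^ (n + 1) ≤ 2 ^ (3 * x + n + 1) := Nat.pow_le_pow_right (by norm_num) (by omega)
    have e3 : 2 ^ (x + 1) ≤ 2 ^ (3 * x + n + 1) := Nat.pow_le_pow_right (by norm_num) (by omega)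
    have e4 : 2 ^ y = 4 * 2 ^ (3 * x + n + 1) := by
      rw [hy, show 3 * x + n + 3 = (3 * x + n + 1) + 2 by ring, pow_add]; ring
    omega
  -- the loss `Q ≤ 2^{c y}`, `2Q ≤ 2^{c y + 1}`, `(2Q)^j ≤ 2^{(c y + 1)(x + 1)}`
  have hQ : (w + K + 2 ^ j + 2) ^ c ≤ 2 ^ (c * y) := by
    calc (w + K + 2 ^ j + 2) ^ c ≤ (2 ^ y) ^ c := Nat.pow_le_pow_left hbase c
      _ = 2 ^ (c * y) := by rw [← pow_mul, mul_comm]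
  have h2Q : 2 * (w + K + 2 ^ j + 2) ^ c ≤ 2 ^ (c * y + 1) := by
    calc 2 * (w + K + 2 ^ j + 2) ^ c ≤ 2 * 2 ^ (c * y) := Nat.mul_le_mul_left 2 hQ
      _ = 2 ^ (c * y + 1) := by ring
  have hpow : (2 * (w + K + 2 ^ j + 2) ^ c) ^ j ≤ 2 ^ ((c * y + 1) * (x + 1)) := by
    calc (2 * (w + K + 2 ^ j + 2) ^ c) ^ j ≤ (2 ^ (c * y + 1)) ^ j := Nat.pow_le_pow_left h2Q j
      _ = 2 ^ ((c * y + 1) * j) := by rw [← pow_mul]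
      _ ≤ 2 ^ ((c * y + 1) * (x + 1)) := Nat.pow_le_pow_right (by norm_num) (Nat.mul_le_mul_left _ hjx)
  have hK1 : K + 1 ≤ 2 ^ (n + 1) := by omega
  -- total exponent
  have htot : (K + 1) * (2 * (w + K + 2 ^ j + 2) ^ c) ^ j ≤ 2 ^ (n + 1 + (c * y + 1) * (x + 1)) := by
    calc (K + 1) * (2 * (w + K + 2 ^ j + 2) ^ c) ^ j ≤ 2 ^ (n + 1) * 2 ^ ((c * y + 1) * (x + 1)) :=
          Nat.mul_le_mul hK1 hpow
      _ = 2 ^ (n + 1 + (c * y + 1) * (x + 1)) := by rw [← pow_add]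
  -- compare exponents
  have hnK : n ≤ K := by
    have h2n : 2 ^ n ≤ K + 1 := by rw [hn]; exact Nat.pow_log_le_self 2 (by omega)
    have : n < 2 ^ n := Nat.lt_two_pow_self
    omega
  have hexp : n + 1 + (c * y + 1) * (x + 1) ≤ n * (A * K) + x ^ A := by
    have := exponent_le_budget c x n K hx2 hnK
    rw [hy, hA]
    exact this
  have h2n : 2 ^ n ≤ K + 1 := by rw [hn]; exact Nat.pow_log_le_self 2 (by omega)
  calc (K + 1) * (2 * (w + K + 2 ^ j + 2) ^ c) ^ j ≤ 2 ^ (n + 1 + (c * y + 1) * (x + 1)) := htot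
    _ ≤ 2 ^ (n * (A * K) + x ^ A) := Nat.pow_le_pow_right (by norm_num) hexp
    _ = (2 ^ n) ^ (A * K) * 2 ^ (x ^ A) := by rw [pow_add, pow_mul]
    _ ≤ (K + 1) ^ (A * K) * 2 ^ (x ^ A) := Nat.mul_le_mul_right _ (Nat.pow_le_pow_left h2n _)

/-! ## Composition -/

/-- **The transfer** (proved modulo the two stubs), with the crux UNFOLDED.  Constants: `C = 0`, `A = 12c + 4`. -/
theorem derivedPencilRolleQuasi_of_stubs (h₁ : DetToImm) (h₂ : HalvingStep) :
    ∃ C A : ℕ, ∀ (m K : ℕ) (S : Fin (K + 1) → Matrix (Fin m) (Fin m) ℝ) (d : Fin (K + 1) → ℕ),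
      (∀ l, (S l).IsSymm) → (∀ l, (S l).det ≠ 0) → StrictMono d →
      ((∑ l, (Polynomial.X : Polynomial ℝ) ^ d l • (S l).map Polynomial.C).det.roots.toFinset.filter
          (fun t => 0 < t)).card ≤
        C * ((∑ l : Fin K, (Polynomial.X : Polynomial ℝ) ^ (d l.succ - d 0 - 1) •
          (((d l.succ - d 0 : ℕ) : ℝ) • S l.succ).map Polynomial.C).det.roots.toFinset.filter
            (fun t => 0 < t)).card + (K + 1) ^ (A * K) * 2 ^ (Nat.log 2 m + 2) ^ A := by
  obtain ⟨c, hc⟩ := h₂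
  refine ⟨0, 12 * c + 4, fun m K S d hS hdet hd => ?_⟩
  rw [zero_mul, zero_add]
  -- normal form: `det` of the pencil is an entry of a product of pencils over the same exponents
  obtain ⟨w, L, hw, hL, M, i, j, hdet⟩ := h₁ m K S d
  -- iterate the halving step `j₀ = ⌊log₂(m+2)⌋ + 1` times: lengths up to `2^{j₀} > m + 2 ≥ L`
  have hiter := entryBound_two_pow d w c (Nat.log 2 (m + 2) + 1) (fun L B h => hc K w L B d h)
    (Nat.log 2 (m + 2) + 1) le_rfl
  have hLj : L ≤ 2 ^ (Nat.log 2 (m + 2) + 1) := by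
    have := Nat.lt_pow_succ_log_self (b := 2) one_lt_two (m + 2)
    rw [Nat.succ_eq_add_one] at this
    omega
  have hentry : posRoots (cocycle d M i j) ≤
      (K + 1) * (2 * (w + K + 2 ^ (Nat.log 2 (m + 2) + 1) + 2) ^ c) ^ (Nat.log 2 (m + 2) + 1) :=
    hiter L hLj M i j
  have hbud := budget_absorbs c m K w hw
  have h := hentry.trans hbud
  rw [← hdet] at h
  unfold posRoots pencil at h
  exact h

/-- **The line's composition**: the crux, BY NAME, from the two stubs (sorry-tainted exactly through `stub_detToImm`,
`stub_halving`; the stub STATEMENTS enter through `derivedPencilRolleQuasi_of_stubs`, whose conclusion is the crux unfolded). -/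
theorem DerivedPencilRolleQuasi_of :
    Summit.ValiantsHypothesis.ValiantsHypothesis.Theses.SymmetroidDescartes.DerivedPencilRolleQuasi :=
  derivedPencilRolleQuasi_of_stubs stub_detToImm stub_halving

end Summit.ValiantsHypothesis.ValiantsHypothesis.Cruxes.DerivedPencilRolleQuasi.ImmHalving
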